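import Summits.QuantumAdvantage.QuantumAdvantage.Theorems.CharDialPartyDialI6

/-!
# PartyDial (decomp-qadv lens-5 g35), part I7 — §8h: the PLAINEST analytic hypothesis `SubsetSumIndep3At` (weights 0/1 = MOD₃ of a subset of the variables) and the reduction ★ `lowDegIndep3At_of_subsetSum : SubsetSumIndep3At p D ε m₀ → LowDegIndep3At p D ε (2m₀)` by conditioning (`card_agree_off`, `card_ovr_count`, `indep_of_conditionings`, `linW_ovr`, `sum_weights_mod`); `SSI3W w k`, `ldi3W_of_ssi3W`, `ldi3_of_ssi3W_one`, `frobHardOdd_iff_manyDeep` (primed form)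

See part A (`CharDialPartyDialA`) for the node header; memo `NODE-g35.md` (g35 folder of decomp-qadv-lens-5).
-/

set_option autoImplicit false
set_option linter.dupNamespace false

namespace Summit.QuantumAdvantage.QuantumAdvantage.Theorems.PartyDial

open Finset
open Summit.QuantumAdvantage.AdviceFreeQNC0

/-! ### §8h  The analytic input in its plainest form: SUBSET-SUM residues (weights `0/1`, i.e. `MOD₃` of a subset of
the variables) suffice — `SubsetSumIndep3At p D ε m₀ → LowDegIndep3At p D ε (2m₀)` by conditioning -/

section SubsetSum

open Literature.Computability.MetaComplexity

variable {m : ℕ}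

/-- **the PLAIN analytic input** `SubsetSumIndep3At p D ε m₀`: a Boolean `f` on `{0,1}^m` of `𝔽_p`-degree `≤ D` is
`ε`-independent of the NUMBER OF ONES mod 3 in any set `S` of `≥ m₀` coordinates: each residue class holds at least
`#f/3 − ε·2^m` of the points of `f`.  [This is `LowDegIndep3At` restricted to weights `0/1` — the shape in print:
low-degree polynomials over `𝔽_p` vs `MOD_3` of (a subset of) the variables (Bourgain 2005, Green–Roy–Straubing
2005, Chattopadhyay 2006); NOT in the tree, NOT proved here.  §8h shows it implies the weighted form, so it is
the ONLY analytic input of §8–§8g.] -/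
def SubsetSumIndep3At (p : ℕ) [Fact p.Prime] (D : ℕ) (ε : ℝ) (m₀ : ℕ) : Prop :=
  ∀ (m : ℕ) (f : (Fin m → Bool) → Bool), HasDegF p f D →
    ∀ (S : Finset (Fin m)), m₀ ≤ S.card →
    ∀ (a r : ℕ), ((univ.filter fun t : Fin m → Bool => f t = true).card : ℝ) / 3 - ε * (2 : ℝ) ^ m ≤
      ((univ.filter fun t : Fin m → Bool => f t = true ∧
        (a + (S.filter fun i => t i = true).card) % 3 = r % 3).card : ℝ)

/-- the weighted form specialises to the subset-sum form (weights = the indicator of `S`). -/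
theorem subsetSumIndep3At_of_lowDeg {p : ℕ} [Fact p.Prime] {D : ℕ} {ε : ℝ} {m₀ : ℕ}
    (h : LowDegIndep3At p D ε m₀) : SubsetSumIndep3At p D ε m₀ := by
  intro m f hf S hS a r
  have hw : m₀ ≤ (univ.filter fun i : Fin m => (if i ∈ S then 1 else 0) % 3 ≠ 0).card := by
    refine hS.trans (le_of_eq ?_)
    congr 1; ext i; by_cases hi : i ∈ S <;> simp [hi]
  have h1 := h m f hf (fun i => if i ∈ S then 1 else 0) hw a r
  have heq : ∀ t : Fin m → Bool, linW (fun i : Fin m => if i ∈ S then 1 else 0) t =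
      (S.filter fun i => t i = true).card := by
    intro t
    unfold linW
    rw [Finset.card_filter, ← Finset.sum_add_sum_compl S]
    have h0 : ∑ i ∈ Sᶜ, (if t i = true then (if i ∈ S then 1 else 0) else 0) = 0 :=
      Finset.sum_eq_zero fun i hi => by
        have : i ∉ S := mem_compl.1 hi
        simp [this]
    rw [h0, add_zero]
    refine Finset.sum_congr rfl fun i hi => ?_
    by_cases ht : t i = true <;> simp [hi, ht]
  have hset : (univ.filter fun t : Fin m → Bool => f t = true ∧
      (a + linW (fun i : Fin m => if i ∈ S then 1 else 0) t) % 3 = r % 3) =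
      univ.filter fun t : Fin m → Bool => f t = true ∧ (a + (S.filter fun i => t i = true).card) % 3 = r % 3 :=
    Finset.filter_congr fun t _ => by rw [heq t]
  rw [hset] at h1
  exact h1

/-- the points agreeing with `u` OFF `X` are `2^{#X}` (free exactly on `X`). -/
theorem card_agree_off (X : Finset (Fin m)) (u : Fin m → Bool) :
    (univ.filter fun t : Fin m → Bool => ∀ i, i ∉ X → t i = u i).card = 2 ^ X.card := by
  classical
  have hc : Fintype.card (↥X → Bool) = 2 ^ X.card := by
    rw [Fintype.card_fun, Fintype.card_bool, Fintype.card_coe]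
  rw [← hc, ← Finset.card_univ]
  refine Finset.card_bij (fun t _ => fun i : ↥X => t i.1) (fun _ _ => mem_univ _) ?_ ?_
  · intro t ht t' ht' h
    funext i
    by_cases hi : i ∈ X
    · exact congrFun h ⟨i, hi⟩
    · rw [(mem_filter.1 ht).2 i hi, (mem_filter.1 ht').2 i hi]
  · intro g _
    refine ⟨fun i => if h : i ∈ X then g ⟨i, h⟩ else u i, mem_filter.2 ⟨mem_univ _, fun i hi => by simp [hi]⟩, ?_⟩
    funext i
    simp [i.2]

/-- counting through the conditioning map `t ↦ ovr X b t`: every point `u` with `u|_X = b|_X` is hit by exactly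
the `2^{#X}` points `t` agreeing with `u` off `X`. -/
theorem card_ovr_count (X : Finset (Fin m)) (b : Fin m → Bool) (P : (Fin m → Bool) → Prop) [DecidablePred P] :
    (univ.filter fun t : Fin m → Bool => P (ovr X b t)).card =
      2 ^ X.card * (univ.filter fun u : Fin m → Bool => (∀ i ∈ X, u i = b i) ∧ P u).card := by
  classical
  set T := univ.filter fun u : Fin m → Bool => (∀ i ∈ X, u i = b i) ∧ P u with hT
  have hmap : ∀ t ∈ (univ.filter fun t : Fin m → Bool => P (ovr X b t)), ovr X b t ∈ T := by
    intro t ht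
    rw [hT, mem_filter]
    exact ⟨mem_univ _, fun i hi => by simp [ovr, hi], (mem_filter.1 ht).2⟩
  rw [Finset.card_eq_sum_card_fiberwise hmap]
  have hfib : ∀ u ∈ T, ((univ.filter fun t : Fin m → Bool => P (ovr X b t)).filter
      fun t => ovr X b t = u).card = 2 ^ X.card := by
    intro u hu
    rw [hT, mem_filter] at hu
    obtain ⟨_, hub, hPu⟩ := hu
    rw [← card_agree_off X u]
    congr 1
    ext t
    simp only [mem_filter, mem_univ, true_and]
    constructor
    · rintro ⟨_, he⟩ i hi
      have := congrFun he i
      simp only [ovr, hi, if_false] at this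
      exact this
    · intro h
      have he : ovr X b t = u := by
        funext i
        by_cases hi : i ∈ X
        · simp [ovr, hi, hub i hi]
        · simp [ovr, hi, h i hi]
      exact ⟨by rw [he]; exact hPu, he⟩
  rw [Finset.sum_congr rfl hfib, Finset.sum_const, smul_eq_mul, mul_comm]

/-- **independence survives conditioning**: if, under EVERY conditioning `b` of the coordinates `X`, the
conditioned function satisfies the `1/3 − ε` bound for a condition `C`, then so does `f` itself. -/
theorem indep_of_conditionings {ε : ℝ} (X : Finset (Fin m)) (f : (Fin m → Bool) → Bool)
    (C : (Fin m → Bool) → Prop) [DecidablePred C]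
    (hfib : ∀ b : Fin m → Bool, ((univ.filter fun t : Fin m → Bool => f (ovr X b t) = true).card : ℝ) / 3 -
      ε * (2 : ℝ) ^ m ≤ ((univ.filter fun t : Fin m → Bool => f (ovr X b t) = true ∧ C (ovr X b t)).card : ℝ)) :
    ((univ.filter fun u : Fin m → Bool => f u = true).card : ℝ) / 3 - ε * (2 : ℝ) ^ m ≤
      ((univ.filter fun u : Fin m → Bool => f u = true ∧ C u).card : ℝ) := by
  classical
  -- fibrewise over `β = u|_X`
  set π : (Fin m → Bool) → (↥X → Bool) := fun u i => u i.1 with hπ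
  set ext : (↥X → Bool) → (Fin m → Bool) := fun β i => if h : i ∈ X then β ⟨i, h⟩ else false with hext
  have hagree : ∀ (β : ↥X → Bool) (u : Fin m → Bool), (∀ i ∈ X, u i = ext β i) ↔ π u = β := by
    intro β u
    constructor
    · intro h; funext i; rw [hπ]; simp only; rw [h i.1 i.2, hext]; simp [i.2]
    · intro h i hi; rw [← h, hext]; simp [hπ, hi]
  have hfibre : ∀ (Q : (Fin m → Bool) → Prop) [DecidablePred Q] (β : ↥X → Bool),
      ((univ.filter fun u : Fin m → Bool => Q u).filter fun u => π u = β) =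
        univ.filter fun u : Fin m → Bool => (∀ i ∈ X, u i = ext β i) ∧ Q u := by
    intro Q _ β
    ext u
    simp only [mem_filter, mem_univ, true_and]
    rw [hagree β u]
    exact And.comm
  have hsumF : ((univ.filter fun u : Fin m → Bool => f u = true).card : ℝ) =
      ∑ β : ↥X → Bool, ((univ.filter fun u : Fin m → Bool => (∀ i ∈ X, u i = ext β i) ∧ f u = true).card : ℝ) := by
    have h := Finset.card_eq_sum_card_fiberwise (s := univ.filter fun u : Fin m → Bool => f u = true)
      (t := (univ : Finset (↥X → Bool))) (f := π) fun _ _ => mem_univ _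
    rw [Finset.sum_congr rfl fun β _ => by rw [hfibre (fun u => f u = true) β]] at h
    exact_mod_cast h
  have hsumC : ((univ.filter fun u : Fin m → Bool => f u = true ∧ C u).card : ℝ) =
      ∑ β : ↥X → Bool, ((univ.filter fun u : Fin m → Bool =>
        (∀ i ∈ X, u i = ext β i) ∧ (f u = true ∧ C u)).card : ℝ) := by
    have h := Finset.card_eq_sum_card_fiberwise (s := univ.filter fun u : Fin m → Bool => f u = true ∧ C u)
      (t := (univ : Finset (↥X → Bool))) (f := π) fun _ _ => mem_univ _
    rw [Finset.sum_congr rfl fun β _ => by rw [hfibre (fun u => f u = true ∧ C u) β]] at h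
    exact_mod_cast h
  have h2X : (0 : ℝ) < (2 : ℝ) ^ X.card := by positivity
  have hper : ∀ β : ↥X → Bool,
      ((univ.filter fun u : Fin m → Bool => (∀ i ∈ X, u i = ext β i) ∧ f u = true).card : ℝ) / 3 -
        ε * (2 : ℝ) ^ m / (2 : ℝ) ^ X.card ≤
      ((univ.filter fun u : Fin m → Bool => (∀ i ∈ X, u i = ext β i) ∧ (f u = true ∧ C u)).card : ℝ) := by
    intro β
    have h := hfib (ext β)
    have e1 := card_ovr_count X (ext β) (fun u => f u = true)
    have e2 := card_ovr_count X (ext β) (fun u => f u = true ∧ C u)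
    have e1' : ((univ.filter fun t : Fin m → Bool => f (ovr X (ext β) t) = true).card : ℝ) = (2 : ℝ) ^ X.card *
        ((univ.filter fun u : Fin m → Bool => (∀ i ∈ X, u i = ext β i) ∧ f u = true).card : ℝ) := by
      exact_mod_cast e1
    have e2' : ((univ.filter fun t : Fin m → Bool => f (ovr X (ext β) t) = true ∧ C (ovr X (ext β) t)).card : ℝ) =
        (2 : ℝ) ^ X.card * ((univ.filter fun u : Fin m → Bool =>
          (∀ i ∈ X, u i = ext β i) ∧ (f u = true ∧ C u)).card : ℝ) := by
      exact_mod_cast e2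
    rw [e1', e2'] at h
    have e3 : (2 : ℝ) ^ X.card * (ε * (2 : ℝ) ^ m / (2 : ℝ) ^ X.card) = ε * (2 : ℝ) ^ m := by field_simp
    refine le_of_mul_le_mul_left ?_ h2X
    rw [mul_sub, e3, ← mul_div_assoc]
    exact h
  have hsum := Finset.sum_le_sum fun β (_ : β ∈ (univ : Finset (↥X → Bool))) => hper β
  rw [Finset.sum_sub_distrib, ← Finset.sum_div, Finset.sum_const, Finset.card_univ, nsmul_eq_mul, ← hsumF,
    ← hsumC] at hsum
  have hcardX : (Fintype.card (↥X → Bool) : ℝ) = (2 : ℝ) ^ X.card := by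
    rw [Fintype.card_fun, Fintype.card_bool, Fintype.card_coe]; push_cast; ring
  rw [hcardX] at hsum
  have he : (2 : ℝ) ^ X.card * (ε * (2 : ℝ) ^ m / (2 : ℝ) ^ X.card) = ε * (2 : ℝ) ^ m := by field_simp
  rw [he] at hsum
  exact hsum

/-- the value of a weighted form under conditioning on `Sᶜ`: the `S`-part plus a constant. -/
theorem linW_ovr (w : Fin m → ℕ) (S : Finset (Fin m)) (b t : Fin m → Bool) :
    linW w (ovr Sᶜ b t) = (∑ i ∈ S, if t i = true then w i else 0) +
      ∑ i ∈ Sᶜ, if b i = true then w i else 0 := by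
  unfold linW
  rw [← Finset.sum_add_sum_compl S]
  congr 1
  · refine Finset.sum_congr rfl fun i hi => ?_
    have : i ∉ Sᶜ := fun h => (mem_compl.1 h) hi
    simp [ovr, this]
  · refine Finset.sum_congr rfl fun i hi => ?_
    simp [ovr, hi]

/-- on a set where every weight is `≡ c (mod 3)`, the weighted count is `c ·` the plain count `(mod 3)`. -/
theorem sum_weights_mod (w : Fin m → ℕ) (S : Finset (Fin m)) (t : Fin m → Bool) {c : ℕ}
    (hc : ∀ i ∈ S, w i % 3 = c) :
    (∑ i ∈ S, if t i = true then w i else 0) % 3 = (c * (S.filter fun i => t i = true).card) % 3 := by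
  rw [Finset.card_filter, Finset.mul_sum, Finset.sum_nat_mod]
  conv_rhs => rw [Finset.sum_nat_mod]
  congr 1
  refine Finset.sum_congr rfl fun i hi => ?_
  by_cases ht : t i = true
  · simp only [ht, if_true, mul_one]
    rw [← hc i hi, Nat.mod_mod]
  · simp [ht]

/-- ★ **THE REDUCTION**: the subset-sum form of the fact gives the weighted form with `2m₀` in place of `m₀`
(split the non-zero weights into `≡ 1` and `≡ 2 (mod 3)`; one class has `≥ m₀` members; condition on everything
else; a weight-`2` count is a weight-`1` count read at the residue `2r`). -/
theorem lowDegIndep3At_of_subsetSum {p : ℕ} [Fact p.Prime] {D : ℕ} {ε : ℝ} {m₀ : ℕ}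
    (h : SubsetSumIndep3At p D ε m₀) : LowDegIndep3At p D ε (2 * m₀) := by
  classical
  intro m f hf w hw a r
  set A := univ.filter fun i : Fin m => w i % 3 = 1 with hA
  set B := univ.filter fun i : Fin m => w i % 3 = 2 with hB
  have hsplit : (univ.filter fun i : Fin m => w i % 3 ≠ 0).card ≤ A.card + B.card := by
    refine (card_le_card fun i hi => ?_).trans (Finset.card_union_le A B)
    have := (mem_filter.1 hi).2
    simp only [mem_union, hA, hB, mem_filter, mem_univ, true_and]
    omega
  -- the generic step: condition on `Sᶜ` for `S ∈ {A, B}` with weights `≡ c` on `S`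
  have step : ∀ (S : Finset (Fin m)) (c : ℕ), (c = 1 ∨ c = 2) → (∀ i ∈ S, w i % 3 = c) → m₀ ≤ S.card →
      ((univ.filter fun t : Fin m → Bool => f t = true).card : ℝ) / 3 - ε * (2 : ℝ) ^ m ≤
        ((univ.filter fun t : Fin m → Bool => f t = true ∧ (a + linW w t) % 3 = r % 3).card : ℝ) := by
    intro S c hc hS hcard
    refine indep_of_conditionings Sᶜ f (fun u => (a + linW w u) % 3 = r % 3) fun b => ?_
    set Cb := ∑ i ∈ Sᶜ, if b i = true then w i else 0 with hCb
    have hdeg : HasDegF p (fun t => f (ovr Sᶜ b t)) D := hasDegF_ovr hf Sᶜ b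
    -- choose the offset / residue so that the weighted condition becomes the subset-sum condition
    obtain ⟨a', r', hiff⟩ : ∃ a' r' : ℕ, ∀ t : Fin m → Bool,
        (a + linW w (ovr Sᶜ b t)) % 3 = r % 3 ↔ (a' + (S.filter fun i => t i = true).card) % 3 = r' % 3 := by
      rcases hc with rfl | rfl
      · refine ⟨a + Cb, r, fun t => ?_⟩
        rw [linW_ovr, ← hCb]
        have hm := sum_weights_mod w S t hS
        rw [one_mul] at hm
        constructor <;> intro h1 <;> omega
      · refine ⟨0, 2 * r + a + Cb, fun t => ?_⟩
        rw [linW_ovr, ← hCb]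
        have hm := sum_weights_mod w S t hS
        constructor <;> intro h1 <;> omega
    have h1 := h m _ hdeg S hcard a' r'
    have hset : (univ.filter fun t : Fin m → Bool => f (ovr Sᶜ b t) = true ∧
        (a' + (S.filter fun i => t i = true).card) % 3 = r' % 3) =
        univ.filter fun t : Fin m → Bool => f (ovr Sᶜ b t) = true ∧ (a + linW w (ovr Sᶜ b t)) % 3 = r % 3 :=
      Finset.filter_congr fun t _ => by rw [hiff t]
    rw [hset] at h1
    exact h1
  by_cases hAc : m₀ ≤ A.card
  · exact step A 1 (Or.inl rfl) (fun i hi => (mem_filter.1 hi).2) hAc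
  · have hBc : m₀ ≤ B.card := by omega
    exact step B 2 (Or.inr rfl) (fun i hi => (mem_filter.1 hi).2) hBc

/-- the plain fact at level `(w, k)`. -/
def SSI3W (w k : ℕ) : Prop :=
  ∀ (p : ℕ) [Fact p.Prime], 5 ≤ p → ∃ m₀ : ℕ,
    SubsetSumIndep3At p (w * 3 ^ k * (p - 1)) (1 / (12 * 2 ^ (w * 3 ^ k))) m₀

/-- the plain fact gives the weighted one at every level (with `2m₀`). -/
theorem ldi3W_of_ssi3W {w k : ℕ} (h : SSI3W w k) : LDI3W w k := by
  intro p _ hp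
  obtain ⟨m₀, hm₀⟩ := h p hp
  exact ⟨2 * m₀, lowDegIndep3At_of_subsetSum hm₀⟩

/-- … and §8's `LDI3 k`. -/
theorem ldi3_of_ssi3W_one {k : ℕ} (h : SSI3W 1 k) : LDI3 k :=
  (ldi3W_one_iff k).1 (ldi3W_of_ssi3W h)

/-- ★ **The dial on T, plainest hypothesis**: GIVEN the subset-sum fact `SSI3W w k`,
`FrobHardOdd ⟺ ManyDeepFrobOdd w k`. -/
theorem frobHardOdd_iff_manyDeep' (w k : ℕ) (hF : SSI3W w k) :
    Summit.QuantumAdvantage.QuantumAdvantage.Theses.CharDial.FrobHardOdd ↔ ManyDeepFrobOdd w k :=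
  frobHardOdd_iff_manyDeep w k (ldi3W_of_ssi3W hF)

end SubsetSum

end Summit.QuantumAdvantage.QuantumAdvantage.Theorems.PartyDial
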